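import Literature.MathematicalPhysics.QuantumFieldTheory.Balaban1983to89.B9Eq3105CoordsDirichletBondLY
import Literature.MathematicalPhysics.QuantumFieldTheory.Balaban1983to89.B9BondReadDomainsPinY
import Literature.MathematicalPhysics.QuantumFieldTheory.Balaban1983to89.B9ThmDCubePlateau

/-!
# `Balaban1983to89.B9Eq3105FamiliesLocalityLY` — [Balaban1985BackgroundPropagators] (3.105) p. 414 ∕ p. 410 l. 14–15: THE FAMILY-WISE LOCALITY LETTER OF THE FOUR (3.105)
# REMAINDER FAMILIES `R_a(U)` (✓`B9Eq3105CoordsDirichletBondLY.eq3105FamQLY`) — the local families `K(h_□)G_□M_{h_□}` (a = 1) and `M_{ζ_□̃}P_{□,1}(∂h_□)G_□M_{h_□}` (a = 4) read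
# `U` near `Ω₀(□)`, the projection families (a = 2, 3) carry the PHYSICAL `DPD*(U)` (the member's global `G′(U)`) and read all of `U` — the predicate `AgreeFamLY`, the reduction
# of the heads' row `hRfagrA` to two operator congruences, and the congruence of family 4 at the (C) letters of record PROVED

T. Bałaban, *Propagators for lattice gauge theories in a background field*, Commun. Math. Phys. **99** (1985) 389–434 [Balaban1985BackgroundPropagators] = [B9]: (3.105) p. 414 («Δ_aG₀ = I −
Σ_□K(h_□)G_□h_□ − Σ_□(1 − ζ_□̃)DPD*h_□G_□h_□ − Σ_□ζ_□̃(DPD* − DP_□D*)h_□G_□h_□ − Σ_□ζ_□̃P_{□,1}(∂h_□)G_□h_□ = I − R»), (3.101) p. 414, (3.25)–(3.27) pp. 394–395 (`P = I − R` with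
the member's `G′(U)`), p. 409 l. 1–5, p. 410 l. 14–15 («the operators G′_□(U), … depend on U restricted to Ω₀(□) ⊂ □̃⁵»), p. 413.

WHY THIS FILE (seat dag-n06-d g34; dag-lead WORDS 849 (3): «family-wise = the honest print letter of (3.105) … banked as an idle-hands support»).  The N06 heads («KE₁₉X-C») display
`hRfagrA : AgreeFA x a U U′ → R_a(U) = R_a(U′)` with a FREE predicate `AgreeFA` (node00-def-Y's word pending: «Eq» ∕ «family-wise»).  The honest letter is family-wise: the
families `a = 2, 3` of (3.105) contain print's PHYSICAL `DPD*(U)` — `DPDsY parKnitY (GpPhysY …) U`, built on the member's GLOBAL `G′(U)` — and are functions of all of `U`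
(their smallness is by norm, (3.106), not by locality); the families `a = 1, 4` are local (they read `U` on the read set of `Ω₀(□)`).  THIS FILE:
* §1 (generic `Gl`, `Plc`, `P1c`): ★ `AgreeFamLY Agr` — `Agr □` on the families 1 ∕ 4, `U = U′` on the families 2 ∕ 3 — and ★★ `eq3105FamQLY_congr_of_agreeFam`: the heads' row shape
  `AgreeFamLY Agr a U U′ → eq3105FamQLY … U a = eq3105FamQLY … U′ a` REDUCED to two operator congruences `h1` (the `K(h_□)`-family) and `h4` (the `ζ_□̃P_{□,1}`-family);
* §2 ★★ family 4 at the (C) letters of record: `M_ζ·P_{□,1}(∂h)(U)·𝟙_B = M_ζ·P_{□,1}(∂h)(U′)·𝟙_B` from def-Y's pointwise locality of `D P_□ D*` (✓`DPDsCubeDY_apply_congr`) under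
  ✓`AgreeDirCY`, for cut-offs `ζ`, `h` supported over `S` — hence ★★ `fam4_congr_of_agreeDirCY` (with `G_□ = 𝟙_B G_□`, ✓`GDirCY_DPDsDirCubeY_congr`) and, at a member with the
  pinned reading domain, ★★★ `fam4_knit_congr_of_agree310WalkYO` (displayed: the support row `supp ζ_□̃ ⊆ Ω₀(□)`).
The `K(h_□)`-family (a = 1) at the knit pair of record is the next file (its congruence runs through ✓`B9KnitCubeRowAgreementY`'s normal forms).
* §3 (v1.1, seat g35) the support rows AT PRINT's PLACEMENT `S := Ω₀(□) = dirDomY i □` are THEOREMS: ★ `mem_dirDomY_of_zetaY_ne_zero` (`supp ζ_□̃ ⊂ □̃ ⊂ NearC 2S_j ⊂ NearH ⊂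
  C_j(□) ⊂ C₁(□) ⊂ Ω₀(□)`: ✓`nearC_of_mem_QbigT` → ✓`nearH_of_nearC` → ✓`InC_of_nearH` → ✓`InC_of_le` → ✓`mem_dirDomC_of_InC`), `mem_dirDomY_of_hTY_ne_zero` (the heads' chain for
  `supp h_□`, packaged) and ★★★ `fam4_knit_congr_of_agree310WalkYO_dirDomY` — family 4 local at the letter of record with NO displayed support row.

HONEST SCOPE.  A `Prop`-valued bookkeeping `def` (the family-wise predicate) + exact finite algebra over landed modules; no estimate; the heads are NOT changed by this file
(`AgreeFA` stays generic until def-Y's word).  Count-neutral (`--supports stmt-QuantumFields-27239`); N06 NOT discharged; nothing continuum ∕ OS ∕ mass gap ∕ Clay — the Yang–Mills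
mass gap is NOT proved by any of this.  NEW file; nothing landed is modified; no `sorry`, no `axiom`, no `instance`, no `notation`.  Net new unproved facts: 0.
-/

noncomputable section

namespace Literature.MathematicalPhysics.QuantumFieldTheory.Balaban1983to89.B9Eq3105FamiliesLocalityLY

open Node00
open B9Thm37CubeCoverCommutators (cutMulY cutMulY_apply hTY)
open B9Eq3104CutoffCommutators (hBdY hBdY_apply DPDsY cutCommR)
open B9Eq3105OfLocalInverseQ (KhBQY)
open B9Eq3105ZetaY (zetaY)
open B9Eq3105CoordsDirichletBondLY (eq3105FamQLY)
open B9CoReadingCoords (XBK)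
open B9WalkLettersBondLeib (coordAlgHomB)
open B6KLevelCensusIndexV1 (KIdx)
open B6Cover236MultiLevelBlocks (cubes)
open B9CubeLettersBondOpsL0 (BlkCubeY IBondCubeY)
open B9PinMembersKLevelV1 (MemberY)
open B9CubeDirInverseBondLocalityY (DPDsCubeDY_apply_congr)
open B9CubeDirInverseBondLocalityAtRecordY (PDirCubeY_congr_of_agree bondReadSetY)
open B9CubeDirInverseBondCLocalityAtRecordY (AgreeDirCY AgreeDirCY.bond IsLocalQC IsLocalQCs GDirCY_DPDsDirCubeY_congr isLocalQC_QknitCubeY isLocalQCs_QsknitCubeY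
  agreeDirCY_of_agree310WalkYO)
open B9DirichletBondCubePairY (QCLetterY QCsLetterY GDirCY indProjY_mul_GDirCY)
open B9Eq3115KnitCubeLetterY (knitDepP QknitCubeY QsknitCubeY GDirCKY)
open B9BondReadDomainsPinY (nearAPinCY bondReadSetY_subset_nearAPinCY knitDep_src_mem_nearAPinCY)
open B9WalkLettersOps310 (agree310WalkYO)
open Node00.OpsYNablaBridge (chartY)
open Node00.OpsYLocalInverse (cubeProjY)
open Node00.OpsYQLetter (QLetterY QsLetterY)
open Node00.OpsYCubeDirInverse (GpDirY GpDirY_mul_cubeProjY)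
open Node00.OpsYCubeKnitPar (parKnitCubeY)
open Node00.OpsYCubeProjectionG (insideBlkY PCubeDY DPDsCubeDY P1CubeDY DPDsDirCubeY P1DirCubeY)
open Node00.OpsYCubeDirInverseBond (indProjY indProjY_apply bondsOverY mem_bondsOverY mem_bondsOverY_of_hBdY_ne_zero)
open scoped Matrix Matrix.Norms.L2Operator

variable {d ℓ : ℕ} {hd : 1 ≤ d + 1} {hL : Odd (ℓ + 1) ∧ 1 < ℓ + 1} {b₀ b₁ : ℝ}

/-! ## §1 The family-wise agreement predicate and the reduction of the heads' row to two operator congruences -/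

section Generic

variable {𝔸 : Type} [NormedRing 𝔸] [NormedAlgebra ℂ 𝔸] [CompleteSpace 𝔸] {κ : Type} [Fintype κ]
variable (i : KIdx d ℓ hd hL b₀ b₁) (b : Module.Basis κ ℝ 𝔸)

/-- ★ **THE FAMILY-WISE AGREEMENT PREDICATE OF THE (3.105) REMAINDER FAMILIES**: on the local families `a = 1` (`K(h_□)G_□M_{h_□}`) and `a = 4` (`M_{ζ_□̃}P_{□,1}(∂h_□)G_□M_{h_□}`) the cube's
agreement predicate `Agr □ U U′` (print: `U = U′` on the read set of `Ω₀(□) ⊂ □̃⁵`); on the projection families `a = 2, 3` — which carry the PHYSICAL `DPD*(U)` of (3.25)–(3.26), a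
function of the member's global `G′(U)` — plain equality `U = U′`. [cite: Balaban1985BackgroundPropagators, (3.105) p.414, (3.25)–(3.27) pp.394–395, p.410 L14–15] -/
def AgreeFamLY (Agr : ↥(cubes i.D.toDomains) → CfgY 𝔸 i → CfgY 𝔸 i → Prop) :
    ↥(cubes i.D.toDomains) ⊕ ↥(cubes i.D.toDomains) ⊕ ↥(cubes i.D.toDomains) ⊕ ↥(cubes i.D.toDomains) → CfgY 𝔸 i → CfgY 𝔸 i → Prop :=
  Sum.elim (fun c U U' => Agr c U U') (Sum.elim (fun _ U U' => U = U') (Sum.elim (fun _ U U' => U = U') (fun c U U' => Agr c U U')))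

variable (𝔮 : QLetterY 𝔸 i) (𝔮s : QsLetterY 𝔸 i) (parS : SiteParY 𝔸 i) (Gp : SiteOpY 𝔸 i)
  (Gl : ↥(cubes i.D.toDomains) → BondOpY 𝔸 i)
  (Plc : ↥(cubes i.D.toDomains) → CfgY 𝔸 i → Module.End ℂ (FBondY i → 𝔸))
  (P1c : ↥(cubes i.D.toDomains) → CfgY 𝔸 i → Module.End ℂ (FBondY i → 𝔸))

/-- ★★ **THE HEADS' ROW `hRfagrA` AT THE FAMILY-WISE LETTER, REDUCED TO TWO OPERATOR CONGRUENCES**: if the `K(h_□)`-family operator and the `ζ_□̃P_{□,1}`-family operator are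
congruent under `Agr □`, then `AgreeFamLY Agr a U U′ → eq3105FamQLY … U a = eq3105FamQLY … U′ a` for EVERY index `a` (families 2 ∕ 3 by `U = U′`).
[cite: Balaban1985BackgroundPropagators, (3.105) p.414, p.410 L14–15] -/
theorem eq3105FamQLY_congr_of_agreeFam (Agr : ↥(cubes i.D.toDomains) → CfgY 𝔸 i → CfgY 𝔸 i → Prop)
    (h1 : ∀ c U U', Agr c U U' →
      KhBQY i (hTY i c) 𝔮 𝔮s U * Gl c U * cutMulY (hBdY i (hTY i c)) = KhBQY i (hTY i c) 𝔮 𝔮s U' * Gl c U' * cutMulY (hBdY i (hTY i c)))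
    (h4 : ∀ c U U', Agr c U U' →
      cutMulY (hBdY i (zetaY i c)) * P1c c U * Gl c U * cutMulY (hBdY i (hTY i c)) =
        cutMulY (hBdY i (zetaY i c)) * P1c c U' * Gl c U' * cutMulY (hBdY i (hTY i c)))
    {a : ↥(cubes i.D.toDomains) ⊕ ↥(cubes i.D.toDomains) ⊕ ↥(cubes i.D.toDomains) ⊕ ↥(cubes i.D.toDomains)} {U U' : CfgY 𝔸 i}
    (h : AgreeFamLY i Agr a U U') : eq3105FamQLY i b 𝔮 𝔮s parS Gp Gl Plc P1c U a = eq3105FamQLY i b 𝔮 𝔮s parS Gp Gl Plc P1c U' a := by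
  rcases a with c | c | c | c
  · simp only [AgreeFamLY, Sum.elim_inl] at h
    simp only [eq3105FamQLY, Sum.elim_inl, h1 c U U' h]
  · simp only [AgreeFamLY, Sum.elim_inr, Sum.elim_inl] at h
    subst h; rfl
  · simp only [AgreeFamLY, Sum.elim_inr, Sum.elim_inl] at h
    subst h; rfl
  · simp only [AgreeFamLY, Sum.elim_inr] at h
    simp only [eq3105FamQLY, Sum.elim_inr, h4 c U U' h]

end Generic

/-! ## §2 Family 4 — `M_{ζ_□̃}·P_{□,1}(∂h_□)(U)·G_□(U)·M_{h_□}` — at the (C) letters of record -/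

section Fam4

variable {𝔸 : Type} [NormedRing 𝔸] [NormedAlgebra ℂ 𝔸] [CompleteSpace 𝔸]
variable (i : KIdx d ℓ hd hL b₀ b₁) (q : ↥(cubes (toKT i).D.toDomains))

/-- `P_{□,1}(∂h)(U)` of the cube sequence, evaluated: `(P₁w)(b) = −(h(b₋)·(DP_□D*w)(b) − (DP_□D*(M_h w))(b))`. [cite: Balaban1985BackgroundPropagators, (3.101) p.414, bookkeeping] -/
theorem P1CubeDY_apply (h : SiteY i → ℝ) (parS : SiteParY 𝔸 i) (Gp : SiteOpY 𝔸 i) (𝔖 : Finset (BlkCubeY i q)) (U : CfgY 𝔸 i) (w : FBondY i → 𝔸) (f : FBondY i) :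
    P1CubeDY i q h parS Gp 𝔖 U w f =
      -((((hBdY i h f : ℝ) : ℂ) • DPDsCubeDY i q parS Gp 𝔖 U w f) - DPDsCubeDY i q parS Gp 𝔖 U (cutMulY (hBdY i h) w) f) := by
  simp only [P1CubeDY, cutCommR, LinearMap.neg_apply, LinearMap.sub_apply, LinearMap.coe_comp, Function.comp_apply, Pi.neg_apply, Pi.sub_apply, cutMulY_apply]

variable {i q} {S : Finset (SiteY i)} {U U' : CfgY 𝔸 i}

/-- ★★ **FAMILY 4's CORE CONGRUENCE**: `M_ζ·P_{□,1}(∂h)(U)·𝟙_B = M_ζ·P_{□,1}(∂h)(U′)·𝟙_B` at the (C) letters of record (`B = bondsOverY S`, `P_□` Dirichlet on `S`), for cut-offs `ζ`, `h`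
whose bond readings are supported over `S`, under ✓`AgreeDirCY` (clauses (i)–(ii): bonds at the sites of `S` and of its `𝔅_□`-block hull).
[cite: Balaban1985BackgroundPropagators, (3.101) p.414, (3.25)–(3.26) pp.394–395, p.410 L14–15] -/
theorem zeta_P1DirCubeY_indProjY_congr {D : IBondCubeY i q → Set (FBondY i)} (hagr : AgreeDirCY i q D S U U')
    (ζ h : SiteY i → ℝ) (hζ : ∀ f, hBdY i ζ f ≠ 0 → f ∈ bondsOverY i S) (hh : ∀ f, hBdY i h f ≠ 0 → f ∈ bondsOverY i S) :
    cutMulY (hBdY i ζ) * P1DirCubeY i q h S U * indProjY (bondsOverY i S) =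
      cutMulY (hBdY i ζ) * P1DirCubeY i q h S U' * indProjY (bondsOverY i S) := by
  have hP : PCubeDY i q (parKnitCubeY i q) (GpDirY i q (parKnitCubeY i q) S) (insideBlkY i q S) U =
      PCubeDY i q (parKnitCubeY i q) (GpDirY i q (parKnitCubeY i q) S) (insideBlkY i q S) U' := PDirCubeY_congr_of_agree i q S hagr.1 hagr.2.1
  have hPr : GpDirY i q (parKnitCubeY i q) S U' * cubeProjY i S = GpDirY i q (parKnitCubeY i q) S U' := GpDirY_mul_cubeProjY i q _ S U'
  refine LinearMap.ext fun A => funext fun f => ?_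
  simp only [Module.End.mul_apply, cutMulY_apply]
  by_cases hz : hBdY i ζ f = 0
  · rw [hz, Complex.ofReal_zero, zero_smul, zero_smul]
  · have hfS : chartY i f.src ∈ S := (mem_bondsOverY i).1 (hζ f hz)
    have hbU : U f.dir f.src = U' f.dir f.src := hagr.bond f hfS
    -- the `𝟙_B`-cut field and its `h`-cut are supported where `U = U′`
    have hA1 : ∀ b', indProjY (bondsOverY i S) A b' ≠ 0 → U b'.dir b'.src = U' b'.dir b'.src := fun b' hb' => by
      refine hagr.bond b' ((mem_bondsOverY i).1 ?_)
      by_contra hn; exact hb' (by rw [indProjY_apply, if_neg hn])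
    have hA2 : ∀ b', cutMulY (hBdY i h) (indProjY (bondsOverY i S) A) b' ≠ 0 → U b'.dir b'.src = U' b'.dir b'.src := fun b' hb' => by
      refine hagr.bond b' ((mem_bondsOverY i).1 (hh b' ?_))
      intro h0; exact hb' (by rw [cutMulY_apply, h0, Complex.ofReal_zero, zero_smul])
    congr 1
    rw [P1CubeDY_apply, P1CubeDY_apply, DPDsCubeDY_apply_congr (insideBlkY i q S) hP hPr hA1 hbU, DPDsCubeDY_apply_congr (insideBlkY i q S) hP hPr hA2 hbU]

/-- ★★ **FAMILY 4 AT A GENERIC CUBE PAIR**: `M_ζ·P_{□,1}(∂h)(U)·G_□(U)·M_h = M_ζ·P_{□,1}(∂h)(U′)·G_□(U′)·M_h` — `G_□ = 𝟙_B G_□` (✓`indProjY_mul_GDirCY`), the core congruence above, and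
`G_□(U) = G_□(U′)` (✓`GDirCY_DPDsDirCubeY_congr`, needs (L2) for the pair). [cite: Balaban1985BackgroundPropagators, (3.105) p.414, (3.101) p.414, p.410 L14–15] -/
theorem fam4_congr_of_agreeDirCY {D : IBondCubeY i q → Set (FBondY i)} {𝔮c : QCLetterY 𝔸 i q} {𝔮cs : QCsLetterY 𝔸 i q}
    (hloc : IsLocalQC i q D 𝔮c) (hlocs : IsLocalQCs i q D 𝔮cs) (hagr : AgreeDirCY i q D S U U')
    (ζ h : SiteY i → ℝ) (hζ : ∀ f, hBdY i ζ f ≠ 0 → f ∈ bondsOverY i S) (hh : ∀ f, hBdY i h f ≠ 0 → f ∈ bondsOverY i S) :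
    cutMulY (hBdY i ζ) * P1DirCubeY i q h S U * GDirCY i q 𝔮c 𝔮cs (DPDsDirCubeY i q S) (bondsOverY i S) U * cutMulY (hBdY i h) =
      cutMulY (hBdY i ζ) * P1DirCubeY i q h S U' * GDirCY i q 𝔮c 𝔮cs (DPDsDirCubeY i q S) (bondsOverY i S) U' * cutMulY (hBdY i h) := by
  rw [GDirCY_DPDsDirCubeY_congr i q hloc hlocs S hagr, ← indProjY_mul_GDirCY i q 𝔮c 𝔮cs (DPDsDirCubeY i q S) (bondsOverY i S) U']
  simp only [← mul_assoc]
  rw [zeta_P1DirCubeY_indProjY_congr hagr ζ h hζ hh]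

/-- ★★ **FAMILY 4 AT THE KNIT PAIR OF RECORD** `G_□ = GDirCKY`: the same with (L2) supplied (✓`isLocalQC_QknitCubeY`, ✓`isLocalQCs_QsknitCubeY`).
[cite: Balaban1985BackgroundPropagators, (3.105) p.414, p.410 L14–15; Balaban1985Averaging, p.24] -/
theorem fam4_knit_congr_of_agreeDirCY {N : ℕ} [Nonempty (Fin N)] {i : KIdx d ℓ hd hL b₀ b₁} {q : ↥(cubes (toKT i).D.toDomains)} {S : Finset (SiteY i)}
    {U U' : CfgY (Matrix (Fin N) (Fin N) ℂ) i} (hagr : AgreeDirCY i q (fun ι => knitDepP i ι.1) S U U')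
    (ζ h : SiteY i → ℝ) (hζ : ∀ f, hBdY i ζ f ≠ 0 → f ∈ bondsOverY i S) (hh : ∀ f, hBdY i h f ≠ 0 → f ∈ bondsOverY i S) :
    cutMulY (hBdY i ζ) * P1DirCubeY i q h S U * GDirCKY i q (DPDsDirCubeY i q S) (bondsOverY i S) U * cutMulY (hBdY i h) =
      cutMulY (hBdY i ζ) * P1DirCubeY i q h S U' * GDirCKY i q (DPDsDirCubeY i q S) (bondsOverY i S) U' * cutMulY (hBdY i h) :=
  fam4_congr_of_agreeDirCY (isLocalQC_QknitCubeY i q) (isLocalQCs_QsknitCubeY i q) hagr ζ h hζ hh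

end Fam4

/-! ### At a member, from the walk reading's agreement predicate at the pinned bond reading domain -/

section Member

variable {N : ℕ} [Nonempty (Fin N)] {Mstar : ℕ} (x : MemberY d ℓ hd hL b₀ b₁ Mstar) (B : B9.Backgrounds)
  (cfg : B.Cfg → CfgY (Matrix (Fin N) (Fin N) ℂ) x.toKIdx) (c : ↥(cubes x.toKIdx.D.toDomains))

/-- ★★★ **FAMILY 4 OF (3.105) IS LOCAL AT THE (C) LETTER OF RECORD**: with `Ω₀ = S`, `ζ = ζ_□̃`, `h = h_□` supported over `S` (displayed support rows) and the bond reading domain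
`near □ = nearAPinCY x.toKIdx □ S` (✓«KE₁₉X-C»'s pin), `agree310WalkYO … near □ U U′` gives the congruence of the family-4 operator `M_ζ·P_{□,1}(∂h)·G_□·M_h`.
[cite: Balaban1985BackgroundPropagators, (3.105) p.414, p.410 L14–15 («depend on U restricted to Ω₀(□) ⊂ □̃⁵»), p.413] -/
theorem fam4_knit_congr_of_agree310WalkYO (S : Finset (SiteY x.toKIdx)) (near : ↥(cubes x.toKIdx.D.toDomains) → Finset (SiteY x.toKIdx))
    (hpin : near c = nearAPinCY x.toKIdx c S) (ζ h : SiteY x.toKIdx → ℝ) (hζ : ∀ z, ζ z ≠ 0 → z ∈ S) (hh : ∀ z, h z ≠ 0 → z ∈ S)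
    {U U' : B.Cfg} (hag : agree310WalkYO x B cfg near c U U') :
    cutMulY (hBdY x.toKIdx ζ) * P1DirCubeY x.toKIdx c h S (cfg U) * GDirCKY x.toKIdx c (DPDsDirCubeY x.toKIdx c S) (bondsOverY x.toKIdx S) (cfg U) *
        cutMulY (hBdY x.toKIdx h) =
      cutMulY (hBdY x.toKIdx ζ) * P1DirCubeY x.toKIdx c h S (cfg U') * GDirCKY x.toKIdx c (DPDsDirCubeY x.toKIdx c S) (bondsOverY x.toKIdx S) (cfg U') *
        cutMulY (hBdY x.toKIdx h) :=
  fam4_knit_congr_of_agreeDirCY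
    (agreeDirCY_of_agree310WalkYO x B cfg c near S (fun ι => knitDepP x.toKIdx ι.1) (hpin ▸ bondReadSetY_subset_nearAPinCY)
      (fun ι hι b' hb' => hpin ▸ knitDep_src_mem_nearAPinCY ι hι b' hb') hag)
    ζ h (fun _ hf => mem_bondsOverY_of_hBdY_ne_zero x.toKIdx hζ hf) (fun _ hf => mem_bondsOverY_of_hBdY_ne_zero x.toKIdx hh hf)

end Member

/-! ## §3 (v1.1)  The support rows at print's placement `S := Ω₀(□) = dirDomY i □`: `supp ζ_□̃ ⊂ Ω₀(□)`, `supp h_□ ⊂ Ω₀(□)`; family 4 with no displayed support row -/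

section Support

open B9Cor35GpDirInputsAtOne (dirDomY)
open B9Eq3105ZetaY (mem_of_zetaY_ne_zero)
open B9ThmDCubePlateau (nearC_of_mem_QbigT)
open B9Cor36CubeCutoffs (nearH_of_nearC one_le_SC)
open B9CubeSequence408 (InC_of_nearH InC_of_le one_le_cube_level)
open B9CubeSequence408Mirrors (mem_dirDomC_of_InC)
open B9CubeLettersOpsL0 (oddMh)
open B9Cor36GCubeLocDefectTransfer (nearH_of_hTY_ne_zero)

variable (i : KIdx d ℓ hd hL b₀ b₁) (c : ↥(cubes (toKT i).D.toDomains))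

/-- ★ **`supp ζ_□̃ ⊂ Ω₀(□)`** at print's placement `Ω₀(□) = dirDomY i □`: a site whose member block lies in `□̃` is within `2S_j ≤ 3S_j` of the centre of `β`
(✓`nearC_of_mem_QbigT`), hence near □ (✓`nearH_of_nearC`), hence in the concentric cube `C_j(□) ⊂ C₁(□)` (✓`InC_of_nearH`, ✓`InC_of_le`), hence in `Ω₀(□)`
(✓`mem_dirDomC_of_InC`). [cite: Balaban1985BackgroundPropagators, p.410 l.14–15 («Ω₀(□) ⊂ □̃⁵»), (3.105) p.414 («ζ_□̃ ∈ C₀^∞(□̃)»), p.408 («Ω₀(□) ⊃ Ω₁(□)»); Balaban1984PropagatorsII, p.239] -/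
theorem mem_dirDomY_of_zetaY_ne_zero {z : SiteY i} (hz : zetaY i c z ≠ 0) : z ∈ dirDomY i c :=
  mem_dirDomC_of_InC hL.1 (oddMh i) (toKT i).hMh (toKT i).hP c
    (InC_of_le (toKT i).hMh (one_le_cube_level c)
      (InC_of_nearH hL.1 (oddMh i) (toKT i).hMh (toKT i).hP
        (nearH_of_nearC i c (by have := one_le_SC i c; omega) (nearC_of_mem_QbigT i c (mem_of_zetaY_ne_zero i c hz) rfl))))

/-- **`supp h_□ ⊂ Ω₀(□)`** at print's placement (the heads' four-lemma chain ✓`nearH_of_hTY_ne_zero` → ✓`InC_of_nearH` → ✓`InC_of_le` → ✓`mem_dirDomC_of_InC`, packaged).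
[cite: Balaban1985BackgroundPropagators, (3.87)–(3.88) p.409, p.410 l.14–15; Balaban1984PropagatorsII, (2.36) p.229] -/
theorem mem_dirDomY_of_hTY_ne_zero {z : SiteY i} (hz : hTY i c z ≠ 0) : z ∈ dirDomY i c :=
  mem_dirDomC_of_InC hL.1 (oddMh i) (toKT i).hMh (toKT i).hP c
    (InC_of_le (toKT i).hMh (one_le_cube_level c) (InC_of_nearH hL.1 (oddMh i) (toKT i).hMh (toKT i).hP (nearH_of_hTY_ne_zero i c hz)))

variable {N : ℕ} [Nonempty (Fin N)] {Mstar : ℕ} (x : MemberY d ℓ hd hL b₀ b₁ Mstar) (B : B9.Backgrounds)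
  (cfg : B.Cfg → CfgY (Matrix (Fin N) (Fin N) ℂ) x.toKIdx) (q : ↥(cubes x.toKIdx.D.toDomains))

/-- ★★★ **FAMILY 4 OF (3.105) IS LOCAL AT THE (C) LETTER OF RECORD, AT PRINT's PLACEMENT, WITH NO DISPLAYED SUPPORT ROW**: `S := Ω₀(□) = dirDomY`, `ζ := ζ_□̃`,
`h := h_□`, bond reading domain `near □ = nearAPinCY x.toKIdx □ Ω₀(□)` (✓«KE₁₉X-C»'s pin): `agree310WalkYO … near □ U U′` gives the congruence of
`M_{ζ_□̃}·P_{□,1}(∂h_□)·G_□·M_{h_□}` — §2's theorem with both support rows discharged by `mem_dirDomY_of_zetaY_ne_zero` ∕ `mem_dirDomY_of_hTY_ne_zero`.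
[cite: Balaban1985BackgroundPropagators, (3.105) p.414, p.410 L14–15 («depend on U restricted to Ω₀(□) ⊂ □̃⁵»), p.413] -/
theorem fam4_knit_congr_of_agree310WalkYO_dirDomY (near : ↥(cubes x.toKIdx.D.toDomains) → Finset (SiteY x.toKIdx))
    (hpin : near q = nearAPinCY x.toKIdx q (dirDomY x.toKIdx q)) {U U' : B.Cfg} (hag : agree310WalkYO x B cfg near q U U') :
    cutMulY (hBdY x.toKIdx (zetaY x.toKIdx q)) * P1DirCubeY x.toKIdx q (hTY x.toKIdx q) (dirDomY x.toKIdx q) (cfg U) *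
        GDirCKY x.toKIdx q (DPDsDirCubeY x.toKIdx q (dirDomY x.toKIdx q)) (bondsOverY x.toKIdx (dirDomY x.toKIdx q)) (cfg U) * cutMulY (hBdY x.toKIdx (hTY x.toKIdx q)) =
      cutMulY (hBdY x.toKIdx (zetaY x.toKIdx q)) * P1DirCubeY x.toKIdx q (hTY x.toKIdx q) (dirDomY x.toKIdx q) (cfg U') *
        GDirCKY x.toKIdx q (DPDsDirCubeY x.toKIdx q (dirDomY x.toKIdx q)) (bondsOverY x.toKIdx (dirDomY x.toKIdx q)) (cfg U') * cutMulY (hBdY x.toKIdx (hTY x.toKIdx q)) :=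
  fam4_knit_congr_of_agree310WalkYO x B cfg q (dirDomY x.toKIdx q) near hpin (zetaY x.toKIdx q) (hTY x.toKIdx q)
    (fun _ hz => mem_dirDomY_of_zetaY_ne_zero x.toKIdx q hz) (fun _ hz => mem_dirDomY_of_hTY_ne_zero x.toKIdx q hz) hag

end Support

end Literature.MathematicalPhysics.QuantumFieldTheory.Balaban1983to89.B9Eq3105FamiliesLocalityLY

end
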